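import Summits.NavierStokesRegularity.NavierStokesRegularity.Theorems.FilamentSkeletonRssSelection1ARcof
import Summits.NavierStokesRegularity.NavierStokesRegularity.Theorems.FilamentSkeletonRssSelection1AR

/-!
# Route `FilamentSkeletonRss` · target `RssProfileExists` (stmt-NavierStokesRegularity-16274) · line `selection_1AR_cof`

CONE-SYNC SKELETON (line-writer seat `linewriter-ns-filamentrss-1-g0`, 2026-08-31).  The target `RssProfileExists` is reached in the
route's certified `closes` (rev 53) through the LANDED selection glue: `selection1AR_proof : SkeletonJ1R → TransverseReduction1AR →
RssProfileExists` (p673139) and its cofinal twin `selection1ARcof_proof : SkeletonJ1Rcof → TransverseReduction1AR → RssProfileExists`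
(item `Selection1ARcof`, stmt-24203, proved).  This file records that dependency as a registered skeleton: the two stubs are the route's
OWN open cruxes BY NAME —

* `stub_skeletonJ1Rcof : SkeletonJ1Rcof` (stmt-NavierStokesRegularity-24202; implied by the crux of record `SkeletonJ1R`, stmt-23610, via the
  landed `skeletonJ1Rcof_of_skeletonJ1R`; line of record for 23610: `Cruxes/SkeletonJ1R/Lines/streamline_kantorovich_R.lean` v7b, open stubs
  F2-d `LiaDefectDerivBL`, L-core′ `CorePinningL1`, K-B′ `KantorovichClosingBL1`, 13-R `Clause13RNearStraightL`);
* `stub_transverseReduction1AR : TransverseReduction1AR` (stmt-NavierStokesRegularity-23611; skeleton of record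
  `Cruxes/TransverseReduction1AR/Lines/…` v6a, stubs `stub_defectFamily1AR`, `stub_waistColumnGateLoc1A`, `stub_gateAssemblyLoc1AR`; parked
  «negative endpoint (MODEL)» by its lead, negative rung `NoExactProfileNearSymmetricPair` stmt-24091);

and `RssProfileExists_of` is the landed glue applied to them (real proof, no `sorry`).  The weaker cofinal ∃-crux is used because it is
what the assembly actually consumes (`Ideas/cofinal-selection.md` of crux 23610); `rssProfileExists_of_record` shows the same composition from the
crux of record.  HONEST LABEL: this line contains NO mathematics of its own — it is the statement, kernel-checked, that the target is exactly as
hard as the pair (∃-side skeleton, ∀-side transverse reduction); every line registered on 23610 / 24202 / 23611 is a line for this target.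
MODEL rung, NEGATIVE side of a hypothetical blow-up scenario; nothing here bears on Navier–Stokes regularity. [folklore]
-/

set_option linter.dupNamespace false

noncomputable section

namespace Summit.NavierStokesRegularity.NavierStokesRegularity.Cruxes.RssProfileExists.Selection1ARCof

open Summit.NavierStokesRegularity.NavierStokesRegularity.Theses.FilamentSkeletonRss

/-- STUB ∃-side · `stub_skeletonJ1Rcof` · XL · the cofinal near-straight in-ball-tangent skeleton family (route item `SkeletonJ1Rcof`,
stmt-NavierStokesRegularity-24202), implied by the crux of record `SkeletonJ1R` (stmt-23610) through the landed
`Theorems.skeletonJ1Rcof_of_skeletonJ1R`. -/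
theorem stub_skeletonJ1Rcof :
    Summit.NavierStokesRegularity.NavierStokesRegularity.Theses.FilamentSkeletonRss.SkeletonJ1Rcof := by
  sorry

/-- STUB ∀-side · `stub_transverseReduction1AR` · XL · the transverse reduction on the R-class (route item `TransverseReduction1AR`,
stmt-NavierStokesRegularity-23611, skeleton of record v6a). -/
theorem stub_transverseReduction1AR :
    Summit.NavierStokesRegularity.NavierStokesRegularity.Theses.FilamentSkeletonRss.TransverseReduction1AR := by
  sorry

/-- **THE TARGET `FilamentSkeletonRss.RssProfileExists` (stmt-NavierStokesRegularity-16274) BY NAME** from the two stubs, by the landed cofinal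
selection glue `selection1ARcof_proof` (item `Selection1ARcof`, stmt-24203, proved).  Real proof; closed modulo the two stub `sorry`s only. -/
theorem RssProfileExists_of :
    Summit.NavierStokesRegularity.NavierStokesRegularity.Theses.FilamentSkeletonRss.RssProfileExists :=
  Summit.NavierStokesRegularity.NavierStokesRegularity.Theorems.selection1ARcof_proof
    stub_skeletonJ1Rcof stub_transverseReduction1AR

/-- The same composition from the crux OF RECORD `SkeletonJ1R` (stmt-23610) — as a real implication (no stub constant): any proof of the
stronger ∃-crux closes the target through `skeletonJ1Rcof_of_skeletonJ1R` and the cofinal glue. -/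
theorem rssProfileExists_of_record :
    Summit.NavierStokesRegularity.NavierStokesRegularity.Theses.FilamentSkeletonRss.SkeletonJ1R →
    Summit.NavierStokesRegularity.NavierStokesRegularity.Theses.FilamentSkeletonRss.TransverseReduction1AR →
    Summit.NavierStokesRegularity.NavierStokesRegularity.Theses.FilamentSkeletonRss.RssProfileExists :=
  fun hSkR hTR =>
    Summit.NavierStokesRegularity.NavierStokesRegularity.Theorems.selection1ARcof_proof
      (Summit.NavierStokesRegularity.NavierStokesRegularity.Theorems.skeletonJ1Rcof_of_skeletonJ1R hSkR) hTR

/-- Cross-check: the record glue `selection1AR_proof` gives the same implication directly. -/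
theorem rssProfileExists_of_record' :
    Summit.NavierStokesRegularity.NavierStokesRegularity.Theses.FilamentSkeletonRss.SkeletonJ1R →
    Summit.NavierStokesRegularity.NavierStokesRegularity.Theses.FilamentSkeletonRss.TransverseReduction1AR →
    Summit.NavierStokesRegularity.NavierStokesRegularity.Theses.FilamentSkeletonRss.RssProfileExists :=
  Summit.NavierStokesRegularity.NavierStokesRegularity.Theorems.selection1AR_proof

end Summit.NavierStokesRegularity.NavierStokesRegularity.Cruxes.RssProfileExists.Selection1ARCof

end
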